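import Literature.Geometry.Symplectic.SteinLiouville
import Literature.Geometry.Symplectic.DefectZeroProofs
import Literature.Probability.RandomPlanarGeometry.LoopWinding
import HarnessLib

/-!
# The twisting number of a framing of a Legendrian knot is a homotopy invariant (TH proved)

Topic `Literature/Geometry/Symplectic`.  `DefectZeroProofs.lean` records as a named fact
`twisting_eq_of_framingHomotopic` (**TH**; Gompf 1998, §1: framings of a Legendrian knot are
compared with the canonical framing *"up to fiber homotopy"*) that the twisting number
`SteinStructure.twisting K ν` — the winding number of the twisting loop
`t ↦ (ω(ċ(t), ν), α(ν))` (`SteinBoundaryContact.lean`) — only depends on the homotopy class of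
the framing `ν` through framings (`FramingHomotopic`), and notes that a proof needs *"the
bundle-level continuity of `ω(ċ, ·)`, `α` along `K`, not yet available"*.  That continuity is
now available (`SteinJBundle.lean`: `J` is a continuous bundle map; `SteinLiouville.lean`: `α`
is continuous on `TW` and `ω = -dd^ℂφ` is a smooth 2-form), and this file **proves TH**:

* `continuous_knotVelocity_bundle` — the velocity `t ↦ (c(t), ċ(t)) ∈ TW` of the unit-period
  parametrisation of a smooth loop is continuous (Mathlib's `tangentMap`);
* `Literature.Geometry.Kaehler.IsSmoothForm.continuousWithinAt_eval` — **a smooth `k`-form evaluated along `k` continuous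
  families of tangent vectors over a common continuous base map is continuous** (general
  manifolds; change of chart `MForm.inChart_eq_of_mem_target` + continuity of the chart
  representative of a smooth form, `MForm.SmoothAt.contDiffWithinAt_inChart`);
* `continuousOn_twistingLoop_family` — the twisting loops of a framing family
  (`IsFramingAlong` the constant isotopy) are jointly continuous on `[0, 1] × ℝ`;
* `twisting_eq_of_framingHomotopic_holds : twisting_eq_of_framingHomotopic` — by the
  free-homotopy invariance of the winding number (`wind_eq_of_homotopy`,
  `Probability/RandomPlanarGeometry/LoopWinding.lean`) applied to the family of twisting loops,
  which never vanish (`IsKnotFraming.twistingLoop_ne_zero`) and have period `1`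
  (`SteinStructure.twistingLoop_add_one`);
* `AkbulutMatveyev1998_defectZero_of_facts'` — the §3 derivation of `DefectZeroProofs.lean`
  with the TH hypothesis discharged.

## References

* R. E. Gompf, *Handlebody construction of Stein surfaces*, Ann. of Math. 148 (1998), §1
  (canonical framing, framings "up to fiber homotopy"). [Gompf1998]
* S. Akbulut, R. Matveyev, IMRN 1998, §3. [AkbulutMatveyev1998]
* W. Fulton, *Algebraic Topology: A First Course* (1995), §3 (homotopy invariance of winding
  numbers).
-/

noncomputable section

open scoped Manifold ContDiff Topology Bundle
open Set Function Bundle Filter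

namespace Literature.Geometry.Symplectic

open Literature.Geometry.Kaehler Literature.Topology.FourManifolds

/-! ### Smooth forms evaluated along continuous families of tangent vectors

General manifolds `M` modelled on `I : ModelWithCorners ℝ E H`; forms with values in `F`
(`Literature.Geometry.Kaehler.MForm`).  The three dot-notation extensions of
`Literature.Geometry.Kaehler.MForm` / `IsSmoothForm` are spelled with their absolute names. -/

section Forms

variable {E : Type*} [NormedAddCommGroup E] [NormedSpace ℝ E] {H : Type*} [TopologicalSpace H]
  {I : ModelWithCorners ℝ E H} {M : Type*} [TopologicalSpace M] [ChartedSpace H M]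
  [IsManifold I ∞ M] {F : Type*} [NormedAddCommGroup F] [NormedSpace ℝ F] {k : ℕ}

/-- The derivative of the inverse chart at `c z`, for `z` in the chart domain of `x₀`, is the
tangent coordinate change `tangentCoordChange I x₀ z z` (applied form, all types read in the
model space `E`). [folklore] -/
theorem mfderivWithin_extChartAt_symm_apply_of_mem_source {x₀ z : M}
    (hz : z ∈ (chartAt H x₀).source) (w : E) :
    ((mfderivWithin 𝓘(ℝ, E) I (extChartAt I x₀).symm (range I) (extChartAt I x₀ z) :
      E →L[ℝ] E) w : E) = tangentCoordChange I x₀ z z w := by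
  have hzs : z ∈ (extChartAt I x₀).source := by rwa [extChartAt_source]
  have hy : extChartAt I x₀ z ∈ (extChartAt I x₀).target := (extChartAt I x₀).map_source hzs
  have hzz : (extChartAt I x₀).symm (extChartAt I x₀ z) = z := (extChartAt I x₀).left_inv hzs
  have h := mfderivWithin_extChartAt_symm_eq_tangentCoordChange (I := I) hy
  have h' : ((mfderivWithin 𝓘(ℝ, E) I (extChartAt I x₀).symm (range I) (extChartAt I x₀ z) :
      E →L[ℝ] E) w : E) =
      (tangentCoordChange I x₀ ((extChartAt I x₀).symm (extChartAt I x₀ z))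
        ((extChartAt I x₀).symm (extChartAt I x₀ z)) : E →L[ℝ] E) w := by
    have := DFunLike.congr_fun h w
    exact this
  rw [hzz] at h'
  exact h'

/-- **The change-of-chart identity for evaluating a form**: for `z` in the chart domain of
`x₀`, `β z (V) = (β.inChart x₀ (c z)) (fun i => (e ⟨z, V i⟩).2)` (`c` the chart and `e` the
trivialization of `TM` at `x₀`). [folklore] -/
theorem _root_.Literature.Geometry.Kaehler.MForm.apply_eq_inChart_apply (β : MForm I M F k) {x₀ z : M}
    (hz : z ∈ (chartAt H x₀).source) (V : Fin k → E) :
    β z V = (β.inChart x₀ (extChartAt I x₀ z))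
      (fun i => ((trivializationAt E (TangentSpace I) x₀) (⟨z, V i⟩ : TangentBundle I M)).2) := by
  have hzs : z ∈ (extChartAt I x₀).source := by rwa [extChartAt_source]
  have hzz : (extChartAt I x₀).symm (extChartAt I x₀ z) = z := (extChartAt I x₀).left_inv hzs
  -- the vectors come back to `V`
  have hvec : ∀ i, ((mfderivWithin 𝓘(ℝ, E) I (extChartAt I x₀).symm (range I) (extChartAt I x₀ z) :
      E →L[ℝ] E) (((trivializationAt E (TangentSpace I) x₀) (⟨z, V i⟩ : TangentBundle I M)).2) : E) =
      V i := fun i => by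
    rw [mfderivWithin_extChartAt_symm_apply_of_mem_source hz]
    have hmem : z ∈ (extChartAt I z).source ∩ (extChartAt I x₀).source ∩ (extChartAt I z).source :=
      ⟨⟨mem_extChartAt_source z, hzs⟩, mem_extChartAt_source z⟩
    -- `(e ⟨z, V i⟩).2 = tangentCoordChange I z x₀ z (V i)` definitionally
    show tangentCoordChange I x₀ z z (tangentCoordChange I z x₀ z (V i)) = V i
    rw [tangentCoordChange_comp hmem, tangentCoordChange_self (mem_extChartAt_source z)]
  -- read `β` as a non-dependent function to rewrite the base point
  set Φ : M → (Fin k → E) → F := fun p w => β p w with hΦ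
  rw [MForm.inChart_apply]
  show Φ z V = Φ ((extChartAt I x₀).symm (extChartAt I x₀ z)) (fun i =>
    ((mfderivWithin 𝓘(ℝ, E) I (extChartAt I x₀).symm (range I) (extChartAt I x₀ z) : E →L[ℝ] E)
      (((trivializationAt E (TangentSpace I) x₀) (⟨z, V i⟩ : TangentBundle I M)).2) : E))
  rw [hzz]
  congr 1
  funext i
  exact (hvec i).symm

/-- **A smooth form evaluated along continuous families of tangent vectors is continuous.**
Let `β` be a smooth `k`-form on `M`, `x : P → M` continuous within `s` at `q₀`, and
`V i : P → E` (`i < k`) vectors over `x` such that each `q ↦ (x q, V i q) ∈ TM` is continuous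
within `s` at `q₀`.  Then `q ↦ β (x q) (V · q)` is continuous within `s` at `q₀`: in the chart
at `x q₀` it reads `(β.inChart x₀ (c (x q))) (e (x q, V i q))ᵢ` (`MForm.apply_eq_inChart_apply`),
the chart representative of a smooth form being continuous on the chart target
(`MForm.SmoothAt.contDiffWithinAt_inChart`) and evaluation being jointly continuous.
[folklore] -/
theorem _root_.Literature.Geometry.Kaehler.IsSmoothForm.continuousWithinAt_eval {β : MForm I M F k} (hβ : IsSmoothForm β)
    {P : Type*} [TopologicalSpace P] {x : P → M} {V : Fin k → P → E} {s : Set P} {q₀ : P}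
    (hx : ContinuousWithinAt x s q₀)
    (hV : ∀ i, ContinuousWithinAt (fun q => (TotalSpace.mk' E (x q) (V i q) : TangentBundle I M)) s q₀) :
    ContinuousWithinAt (fun q => β (x q) (fun i => V i q)) s q₀ := by
  have hU0 : x q₀ ∈ (chartAt H (x q₀)).source := mem_chart_source H (x q₀)
  -- restrict to `s' = s ∩ x ⁻¹' U`
  have hUs : x ⁻¹' (chartAt H (x q₀)).source ∈ 𝓝[s] q₀ :=
    hx.preimage_mem_nhdsWithin ((chartAt H (x q₀)).open_source.mem_nhds hU0)
  rw [← continuousWithinAt_inter' hUs]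
  have hx' : ContinuousWithinAt x (s ∩ x ⁻¹' (chartAt H (x q₀)).source) q₀ :=
    hx.mono inter_subset_left
  have hV' : ∀ i, ContinuousWithinAt
      (fun q => (TotalSpace.mk' E (x q) (V i q) : TangentBundle I M))
      (s ∩ x ⁻¹' (chartAt H (x q₀)).source) q₀ := fun i =>
    (hV i).mono inter_subset_left
  -- the chart representative of `β` is continuous on the chart target
  have hβc : ContinuousOn (β.inChart (x q₀)) (extChartAt I (x q₀)).target := fun y hy => by
    have hz : (extChartAt I (x q₀)).symm y ∈ (extChartAt I (x q₀)).source :=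
      (extChartAt I (x q₀)).map_target hy
    have h := MForm.SmoothAt.contDiffWithinAt_inChart (α := β) hz (hβ ((extChartAt I (x q₀)).symm y))
    rw [(extChartAt I (x q₀)).right_inv hy] at h
    exact h.continuousWithinAt.mono (extChartAt_target_subset_range (x q₀))
  -- `q ↦ β.inChart x₀ (c (x q))` is continuous within `s'`
  have hA : ContinuousWithinAt (fun q => β.inChart (x q₀) (extChartAt I (x q₀) (x q)))
      (s ∩ x ⁻¹' (chartAt H (x q₀)).source) q₀ := by
    have h1 : ContinuousWithinAt (fun q => extChartAt I (x q₀) (x q))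
        (s ∩ x ⁻¹' (chartAt H (x q₀)).source) q₀ :=
      (continuousAt_extChartAt (I := I) (x q₀)).comp_continuousWithinAt hx'
    refine ContinuousWithinAt.comp (f := fun q => extChartAt I (x q₀) (x q))
      (hβc _ (mem_extChartAt_target (x q₀))) h1 fun q hq => (extChartAt I (x q₀)).map_source ?_
    rw [extChartAt_source]; exact hq.2
  -- the vectors in the trivialization are continuous within `s'`
  have hT : ContinuousWithinAt (fun q => fun i =>
      ((trivializationAt E (TangentSpace I) (x q₀))
        (TotalSpace.mk' E (x q) (V i q) : TangentBundle I M)).2)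
      (s ∩ x ⁻¹' (chartAt H (x q₀)).source) q₀ := by
    refine continuousWithinAt_pi.2 fun i => ?_
    have hsrc : (TotalSpace.mk' E (x q₀) (V i q₀) : TangentBundle I M) ∈
        (trivializationAt E (TangentSpace I) (x q₀)).source :=
      (trivializationAt E (TangentSpace I) (x q₀)).mem_source.2 hU0
    have h2 := ContinuousAt.comp_continuousWithinAt
      (f := fun q => (TotalSpace.mk' E (x q) (V i q) : TangentBundle I M))
      ((trivializationAt E (TangentSpace I) (x q₀)).continuousAt hsrc) (hV' i)
    exact continuous_snd.continuousAt.comp_continuousWithinAt h2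
  -- evaluate, and compare with `β (x q) (V · q)` on `s'`
  have hev := hA.eval hT
  refine hev.congr_of_eventuallyEq (eventually_of_mem self_mem_nhdsWithin fun q hq => ?_) ?_
  · exact β.apply_eq_inChart_apply hq.2 _
  · exact β.apply_eq_inChart_apply hU0 _

/-- `2`-form version of `IsSmoothForm.continuousWithinAt_eval` with the vectors given as
`![u q, v q]`. [folklore] -/
theorem _root_.Literature.Geometry.Kaehler.IsSmoothForm.continuousWithinAt_eval₂ {β : MForm I M F 2} (hβ : IsSmoothForm β)
    {P : Type*} [TopologicalSpace P] {x : P → M} {u v : P → E} {s : Set P} {q₀ : P}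
    (hx : ContinuousWithinAt x s q₀)
    (hu : ContinuousWithinAt (fun q => (TotalSpace.mk' E (x q) (u q) : TangentBundle I M)) s q₀)
    (hv : ContinuousWithinAt (fun q => (TotalSpace.mk' E (x q) (v q) : TangentBundle I M)) s q₀) :
    ContinuousWithinAt (fun q => β (x q) ![u q, v q]) s q₀ := by
  have h := hβ.continuousWithinAt_eval (V := ![u, v]) hx fun i => by
    fin_cases i
    · exact hu
    · exact hv
  refine h.congr (fun q _ => ?_) ?_
  · congr 1; funext i; fin_cases i <;> rfl
  · congr 1; funext i; fin_cases i <;> rfl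

end Forms

/-- The model vector space `ℝ⁴` of the tangent spaces. [folklore] -/
local notation "E4" => EuclideanSpace ℝ (Fin 4)

/-- Local notation: `𝕊 n` is the unit sphere in `EuclideanSpace ℝ (Fin (n + 1))`. -/
local notation "𝕊 " n:arg => (Metric.sphere (0 : EuclideanSpace ℝ (Fin (n + 1))) 1)

/-! ### The velocity of a smooth loop is a continuous curve in `TW` -/

variable {W : Type*} [TopologicalSpace W] [ChartedSpace (EuclideanHalfSpace 4) W]
  [IsManifold (𝓡∂ 4) ∞ W]

/-- **The velocity `t ↦ (c(t), ċ(t))` of the unit-period parametrisation `c = K ∘ circlePt` of a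
smooth loop `K` is a continuous curve in `TW`** (it is `tangentMap (K ∘ circlePt) (t, 1)`).
[folklore] -/
theorem continuous_knotVelocity_bundle {K : 𝕊 1 → W} (hK : ContMDiff (𝓡 1) (𝓡∂ 4) ∞ K) :
    Continuous fun t : ℝ =>
      (TotalSpace.mk' E4 (K (circlePt t)) (knotVelocity K t) : TangentBundle (𝓡∂ 4) W) := by
  have hc : ContMDiff 𝓘(ℝ, ℝ) (𝓡∂ 4) ∞ (K ∘ circlePt) := hK.comp contMDiff_circlePt
  have h1 : Continuous (tangentMap 𝓘(ℝ, ℝ) (𝓡∂ 4) (K ∘ circlePt)) :=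
    hc.continuous_tangentMap (by simp)
  have h2 : Continuous fun t : ℝ =>
      ((tangentBundleModelSpaceHomeomorph 𝓘(ℝ, ℝ)).symm (t, (1 : ℝ)) : TangentBundle 𝓘(ℝ, ℝ) ℝ) :=
    (tangentBundleModelSpaceHomeomorph 𝓘(ℝ, ℝ)).symm.continuous.comp
      (continuous_id.prodMk continuous_const)
  exact h1.comp h2

/-! ### Joint continuity of the twisting loops of a framing family -/

variable [CompactSpace W] [T2Space W]

/-- **The twisting loops of a framing family are jointly continuous.**  For a Legendrian knot
`K` and a family `νt` of framings of `K` carried along the constant isotopy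
(`IsFramingAlong (refl) ν νt`: jointly continuous into `TW` on `[0, 1] × S¹`), the map
`(s, t) ↦ twistingLoop K (νt s) t = (ω(ċ(t), νt s), α(νt s))` is continuous on `[0, 1] × ℝ`
(`IsSmoothForm.continuousWithinAt_eval₂` for `ω`, `ContinuousWithinAt.contactForm_apply` for
`α`, `continuous_knotVelocity_bundle` for `ċ`). [folklore] -/
theorem continuousOn_twistingLoop_family (S : SteinStructure W) {K : 𝕊 1 → W}
    (hK : IsLegendrianKnot S.J K) {ν : 𝕊 1 → E4} {νt : ℝ → 𝕊 1 → E4}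
    (hfr : IsFramingAlong (KnotIsotopyInBoundary.refl hK.isBoundaryKnot) ν νt) :
    ContinuousOn (fun p : ℝ × ℝ => S.twistingLoop K (νt p.1) p.2) (Icc 0 1 ×ˢ univ) := by
  intro q hq
  -- the framing vectors `(s, t) ↦ (K (c t), νt s (c t))` are continuous into `TW`
  have hνc : ContinuousWithinAt (fun p : ℝ × ℝ =>
      (TotalSpace.mk' E4 (K (circlePt p.2)) (νt p.1 (circlePt p.2)) : TangentBundle (𝓡∂ 4) W))
      (Icc 0 1 ×ˢ univ) q := by
    have h := hfr.continuousOn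
    have hg : Continuous fun p : ℝ × ℝ => (p.1, circlePt p.2) :=
      continuous_fst.prodMk (continuous_circlePt.comp continuous_snd)
    have hmaps : MapsTo (fun p : ℝ × ℝ => (p.1, circlePt p.2)) (Icc (0 : ℝ) 1 ×ˢ univ)
        (Icc (0 : ℝ) 1 ×ˢ univ) := fun p hp => ⟨hp.1, mem_univ _⟩
    exact (h.comp hg.continuousOn hmaps) q hq
  -- the velocity `(s, t) ↦ (K (c t), ċ t)` is continuous into `TW`
  have hvel : ContinuousWithinAt (fun p : ℝ × ℝ =>
      (TotalSpace.mk' E4 (K (circlePt p.2)) (knotVelocity K p.2) : TangentBundle (𝓡∂ 4) W))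
      (Icc 0 1 ×ˢ univ) q :=
    ((continuous_knotVelocity_bundle hK.isSmoothEmbedding.contMDiff).comp
      continuous_snd).continuousWithinAt
  have hx : ContinuousWithinAt (fun p : ℝ × ℝ => K (circlePt p.2)) (Icc 0 1 ×ˢ univ) q :=
    ((hK.isSmoothEmbedding.contMDiff.continuous.comp continuous_circlePt).comp
      continuous_snd).continuousWithinAt
  -- the two components
  have hω : ContinuousWithinAt (fun p : ℝ × ℝ =>
      S.kahlerForm (K (circlePt p.2)) (knotVelocity K p.2) (νt p.1 (circlePt p.2)))
      (Icc 0 1 ×ˢ univ) q :=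
    (S.isSmoothForm_kahler.continuousWithinAt_eval₂ hx hvel hνc).neg
  have hα : ContinuousWithinAt (fun p : ℝ × ℝ =>
      S.contactForm (K (circlePt p.2)) (νt p.1 (circlePt p.2))) (Icc 0 1 ×ˢ univ) q :=
    ContinuousWithinAt.contactForm_apply S hνc
  -- assemble the complex number
  have hform : (fun p : ℝ × ℝ => S.twistingLoop K (νt p.1) p.2) = fun p =>
      ((S.kahlerForm (K (circlePt p.2)) (knotVelocity K p.2) (νt p.1 (circlePt p.2)) : ℝ) : ℂ) +
        (S.contactForm (K (circlePt p.2)) (νt p.1 (circlePt p.2)) : ℂ) * Complex.I := by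
    funext p
    rw [SteinStructure.twistingLoop_apply, Complex.mk_eq_add_mul_I]
  rw [hform]
  exact (Complex.continuous_ofReal.continuousAt.comp_continuousWithinAt hω).add
    ((Complex.continuous_ofReal.continuousAt.comp_continuousWithinAt hα).mul
      continuousWithinAt_const)

/-! ### TH: the twisting number is a homotopy invariant of the framing -/

/-- **Discharge of the named fact `twisting_eq_of_framingHomotopic` (TH).**  For a Legendrian
knot `K` in the boundary of a compact Stein `W` and framings `ν`, `ν'` of `K` homotopic through
framings, `twisting K ν = twisting K ν'`: the twisting loops of the connecting framing family
form a free homotopy of loops in `ℂ ∖ {0}` (`continuousOn_twistingLoop_family`,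
`IsKnotFraming.twistingLoop_ne_zero`, `SteinStructure.twistingLoop_add_one`), along which the
winding number is constant (`wind_eq_of_homotopy`). [cite: Gompf1998, §1] -/
theorem twisting_eq_of_framingHomotopic_holds : twisting_eq_of_framingHomotopic := by
  intro W _ _ _ _ _ S K ν ν' hK hhom
  obtain ⟨hBK, νt, hfr, h1⟩ := hhom
  have h0 : νt 0 = ν := hfr.apply_zero
  subst h1
  subst h0
  have hfr' : IsFramingAlong (KnotIsotopyInBoundary.refl hK.isBoundaryKnot) (νt 0) νt := hfr
  have hKd : MDifferentiable (𝓡 1) (𝓡∂ 4) K :=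
    hK.isSmoothEmbedding.contMDiff.mdifferentiable (by simp)
  show Literature.Topology.PlaneTopology.wind (S.twistingLoop K (νt 0)) =
    Literature.Topology.PlaneTopology.wind (S.twistingLoop K (νt 1))
  refine Literature.Probability.RandomPlanarGeometry.wind_eq_of_homotopy
    (fun s t => S.twistingLoop K (νt s) t) ?_ ?_ ?_
  · -- joint continuity on the square
    exact (continuousOn_twistingLoop_family S hK hfr').mono
      (prod_mono Subset.rfl (subset_univ _))
  · -- the loops never vanish
    intro s hs t _
    have hνs : IsKnotFraming K (νt s) := hfr'.isKnotFraming s hs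
    exact hνs.twistingLoop_ne_zero hK t
  · -- period `1`
    intro s _
    have h := S.twistingLoop_add_one hKd (νt s) 0
    rw [zero_add] at h
    exact h.symm

/-- **Akbulut–Matveyev's defect-zero criterion from Eliashberg's theorem, TH discharged**: the
§3 derivation `AkbulutMatveyev1998_defectZero_of_facts` with the homotopy invariance of the
twisting number now proved (`twisting_eq_of_framingHomotopic_holds`); the remaining hypotheses
are E2 (Eliashberg), ST (stabilisation), ISO and TUBE. [cite: AkbulutMatveyev1998, §3] -/
theorem AkbulutMatveyev1998_defectZero_of_facts' (hE : Gompf1998_thm13_twoHandles)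
    (hST : Gompf1998_addLeftTwists) (hISO : HandleAttachingMap.isMultiAttachment_of_linkIsotopyInBoundary)
    (hT : exists_handleAttachingMap_of_isKnotFraming)
    (W P : Type) [TopologicalSpace W] [T2Space W] [ChartedSpace (EuclideanHalfSpace 4) W]
    [IsManifold (𝓡∂ 4) ∞ W] [CompactSpace W] [TopologicalSpace P]
    [ChartedSpace (EuclideanHalfSpace 4) P] [IsManifold (𝓡∂ 4) ∞ P] [CompactSpace P]
    (ho : IsOrientable (𝓡∂ 4) W) (S : SteinStructure W) (ι : Type) [Finite ι]
    (h : ι → HandleAttachingMap 3 2 W) (hP : HandleAttachingMap.IsMultiAttachment h (𝓡∂ 4) P)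
    (hLeg : ∀ i, IsLegendrianKnot S.J (h i).attachingCircle)
    (hd : ∀ i, S.defect (h i).attachingCircle (h i).attachingFraming = 0) : IsSteinDomain P :=
  AkbulutMatveyev1998_defectZero_of_facts hE hST hISO hT twisting_eq_of_framingHomotopic_holds
    W P ho S ι h hP hLeg hd

end Literature.Geometry.Symplectic

end
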